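/-
Copyright (c) 2026 the pub-hodgecm-mathlib formalisation cell (harness21).  Prover seat hodgecm-mathlib-K2E3-p23 (g8), Track B «K2-LIT» ∕ hLiu418 #184♮,
Road I v3, unit U5 «THE CLOSE», FACE-D₀ row `h2₂`, the additive-character TOWER BRICK behind the S-letter `hχ` of ★ p863240 ∕ ★ p863332
(self-named under chair VALVE WORD W4 toward the owed §2 of ★ p863351 `K2LiuFirstTermLineLiftRankRowSmallLetters`, K2 bus 2026-09-05T00:1xZ).  THEOREMS ONLY.
-/
import Literature.NumberTheory.Automorphic.AdeleAddCharGaloisEquivariance   -- ★ `exists_sub_mem_adicCompletionIntegers_and_forall`, `adeleAddCharAt_galAdicCompletionMap` (+ `adeleAddCharAt_eq_of_sub_mem`)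
import Literature.NumberTheory.Automorphic.QuadraticLocalBaseChange         -- ★ `UnitaryGroup.toPlace`, `toPlace_coe`, `toPlace_mem_adicCompletionIntegers`, `galAdicCompletionMap_toPlace`, `Fintype (PlacesOver E v)`
import Literature.NumberTheory.Automorphic.GlobalAdditiveCharacter            -- ★ `AddChar.adicComponent` (the (d1) spelling of the local components)
import Literature.Analysis.Fourier.ContinuousAddCharReal                     -- ★ `addChar_map_finset_sum` (an additive character of a finite sum)
import HarnessLib

/-!
# K2_Liu road (hLiu418 = stmt-HodgeConjecture-24832), U5 «THE CLOSE», FACE-D₀ row `h2₂`: TATE'S ADDITIVE CHARACTER IN A TOWER `E ∕ F`, RESTRICTED FORM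
# `∏_{w ∣ v} ψ_{E,w}(ι_w t) = ψ_{F,v}(t)^{[E:F]}` for `t ∈ F_v`

Cell `pub/hodgecm-mathlib` (D-0151), Track B, build stream 29; helper lane `--supports stmt-HodgeConjecture-24832 --as helper`, count-neutral; closes no socket.
THEOREMS ONLY (no `def`, no `instance`, no notation, no named-fact hypothesis, no `sorry`).

WHY.  On FACE-D₀'s row `h2₂` the theta side's unipotent character `ψ_S = unipDeltaChar S` is built on Tate's character `ψ_L = adeleAddChar L` of `𝔸_L` (★ Φ1
`K2LiuSiegelUnipotentFourierDefs.unipDeltaChar`, local factors ★ (d1) `K2LiuSiegelUnipotentCharacterFactorisation.unipDeltaChar_locToAdelic_eq_prod`: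
`ψ_S(ι_v y) = ∏_{w∣v} ψ_{L,w}(tr(S X(y))_w)`), while the chirp multipliers of the Weil representation `pairRep (Fp L) L …` are built on `ψ_{L⁺} = adeleAddChar (Fp L)`
(★ `Weil1964.AdelicMetaplecticFiniteImplementer`).  The S-letter `hχ` of ★ `K2LiuFirstTermLineLiftRankRowModel{,Conj}` («`χ z = ψ(π (b z) βloc)`» with `χ = ψ_S ∘ ι`,
★ p863351 §1.3) therefore needs the two towers of local characters compared on `L⁺_v`.  The tree had Galois equivariance (★ `adeleAddCharAt_galAdicCompletionMap`)
but no tower identity (`rg adeleRelTrace × adeleAddChar = ∅`).  THIS FILE proves the RESTRICTED tower identity — on elements of `F_v` only, which is all `hχ` reads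
(the hermitian pairing `tr(b·βloc)` is `σ`-fixed) — by Tate's global approximation, WITHOUT the integrality of local traces that the full identity
`ψ_{E,w} = ψ_{F,v} ∘ Tr_{E_w∕F_v}` would need:
* §1 `adeleEval_sum_adeleSingleHom_of_over ∕ _of_not_over` (coordinates of the adele
  `Σ_{w∣v} (ι_w t at w)`), `coe_algebraMap_mem_adicCompletionIntegers_of_under` (a global `k ∈ F` integral at `u.under` is integral at `u` in `E`);
* §2 **`prod_adeleAddCharAt_toPlace_eq_pow`** — `∏_{w : PlacesOver E v} ψ_{E,w}(toPlace v w t) = ψ_{F,v}(t) ^ finrank F E` (`t ∈ F_v`): pick `k ∈ F` with `t ≡ k (mod 𝒪_v)`,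
  integral elsewhere (★ `exists_sub_mem_adicCompletionIntegers_and_forall`); then `ψ_{F,v}(t) = e(Tr_{F∕ℚ} k)` (★ `adeleAddCharAt_eq_of_sub_mem`) and the adele
  `x = Σ_{w∣v} (ι_w t at w)` is `≡ k` modulo finite-integral adeles (★ `toPlace_mem_adicCompletionIntegers`), so `ψ_E(x) = e(Tr_{E∕ℚ} k) = e([E:F]·Tr_{F∕ℚ} k)`
  (★ `adeleTraceMod_eq`, ★ `infiniteAdeleTrace_algebraMap`, Mathlib `Algebra.trace_trace`, `Algebra.trace_algebraMap`); `adicComponent` spelling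
  `prod_adicComponent_adeleAddChar_toPlace_eq_pow`.
* §3 corollaries for the (hχ) instance: **`adeleAddCharAt_toPlace_eq_pow_of_forall_eq`** (ONE place over `v`, e.g. `v` inert or ramified in a CM `L∕L⁺`:
  `ψ_{E,w}(ι_w t) = ψ_{F,v}(t)^{[E:F]}`), **`adeleAddCharAt_toPlace_eq_of_smul_eq`** (Galois-conjugate places over `v` have the same local character on `ι(F_v)`),
  **`adeleAddCharAt_toPlace_eq_of_pair`** (TWO Galois-conjugate places over `v` and `[E:F] = 2`, e.g. `v` split in a CM `L∕L⁺`: `ψ_{E,w}(ι_w t) = ψ_{F,v}(t)`).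

References: [CasselsFrohlichANT1967] J. Tate, *Fourier analysis in number fields and Hecke's zeta-functions*, Ch. XV in Cassels–Fröhlich (1967), §2.2 (local `ψ_𝔭 =
λ ∘ Tr`), Lemma 4.1.3, Thm. 4.1.1, §4.1; J. W. S. Cassels, *Global fields*, ibid. Ch. II §11, §19 (19.18); [Tate1950] J. Tate, thesis (1950) §2.2, §4.1;
[Weil1964] A. Weil, Acta Math. 111 (1964) n° 26 (characters of `X_A` in a tower).
HONEST LABEL: HC_CM is proved only modulo the 7 printed citations (2 remaining named inputs: hLiu418 = stmt-HodgeConjecture-24832, h413 = stmt-HodgeConjecture-24833)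
until rung 0 closes; this file moves no counter; `h2₂` NOT discharged.
-/

set_option autoImplicit false
set_option linter.dupNamespace false -- the mandated namespace repeats `HodgeConjecture.HodgeConjecture`

noncomputable section

open scoped Classical
open NumberField IsDedekindDomain
open Literature.NumberTheory.Automorphic Literature.NumberTheory.Automorphic.UnitaryGroup

namespace Summit.HodgeConjecture.HodgeConjecture.Cruxes.HLiu418.K2LiuAdeleAddCharTower

/-! ## §1 Bookkeeping -/
section Bookkeeping

variable (F E : Type) [Field F] [NumberField F] [Field E] [NumberField E] [Algebra F E]

/-- coordinate AT A PLACE OVER `v` of the adele `Σ_{w ∣ v} (y_w at w)`: it is `y_u`. [cite: CasselsFrohlichANT1967, Ch. II §14] -/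
theorem adeleEval_sum_adeleSingleHom_of_over (v : HeightOneSpectrum (𝓞 F)) (y : ∀ w : PlacesOver E v, w.1.adicCompletion E)
    (u : HeightOneSpectrum (𝓞 E)) (hu : u.under (𝓞 F) = v) :
    (∑ w : PlacesOver E v, adeleSingleHom E w.1 (y w)).2 u = y ⟨u, hu⟩ := by
  have h2 : (∑ w : PlacesOver E v, adeleSingleHom E w.1 (y w)).2 u =
      ∑ w : PlacesOver E v, AdelicGroupData.adeleEval E u (adeleSingleHom E w.1 (y w)) := by
    rw [← map_sum]
    rfl
  rw [h2, Finset.sum_eq_single (⟨u, hu⟩ : PlacesOver E v)]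
  · exact adeleEval_adeleSingleHom E u (y ⟨u, hu⟩)
  · intro w _ hw
    have hne : u ≠ w.1 := fun h => hw (Subtype.ext h.symm)
    change (adeleSingleHom E w.1 (y w)).2 u = 0
    rw [adeleSingleHom_apply_snd, finiteAdeleSingleHom_apply_of_ne E w.1 (y w) hne]
  · exact fun h => (h (Finset.mem_univ _)).elim

/-- coordinate OFF `v` of the adele `Σ_{w ∣ v} (y_w at w)`: it is `0`. [cite: CasselsFrohlichANT1967, Ch. II §14] -/
theorem adeleEval_sum_adeleSingleHom_of_not_over (v : HeightOneSpectrum (𝓞 F)) (y : ∀ w : PlacesOver E v, w.1.adicCompletion E)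
    (u : HeightOneSpectrum (𝓞 E)) (hu : u.under (𝓞 F) ≠ v) :
    (∑ w : PlacesOver E v, adeleSingleHom E w.1 (y w)).2 u = 0 := by
  have h2 : (∑ w : PlacesOver E v, adeleSingleHom E w.1 (y w)).2 u =
      ∑ w : PlacesOver E v, AdelicGroupData.adeleEval E u (adeleSingleHom E w.1 (y w)) := by
    rw [← map_sum]
    rfl
  rw [h2]
  refine Finset.sum_eq_zero fun w _ => ?_
  have hne : u ≠ w.1 := fun h => hu (by rw [h]; exact w.2)
  change (adeleSingleHom E w.1 (y w)).2 u = 0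
  rw [adeleSingleHom_apply_snd, finiteAdeleSingleHom_apply_of_ne E w.1 (y w) hne]

/-- the archimedean part of the adele `Σ_{w ∣ v} (y_w at w)` vanishes. [cite: CasselsFrohlichANT1967, Ch. II §14] -/
theorem fst_sum_adeleSingleHom (v : HeightOneSpectrum (𝓞 F)) (y : ∀ w : PlacesOver E v, w.1.adicCompletion E) :
    (∑ w : PlacesOver E v, adeleSingleHom E w.1 (y w)).1 = 0 := by
  refine Finset.sum_induction _ (fun a : AdeleRing (𝓞 E) E => a.1 = 0) (fun a b ha hb => ?_) rfl
    (fun w _ => adeleSingleHom_apply_fst E w.1 (y w))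
  change a.1 + b.1 = 0
  rw [ha, hb, add_zero]

/-- a global element `k ∈ F` which is a local integer at the place `u.under` of `F` is a local integer at `u` in `E` (★ `toPlace_mem_adicCompletionIntegers` at the
structure map `ι_u : F_{u.under} → E_u`, ★ `toPlace_coe`). [cite: CasselsFrohlichANT1967, Ch. II §11] -/
theorem coe_algebraMap_mem_adicCompletionIntegers_of_under (u : HeightOneSpectrum (𝓞 E)) (k : F)
    (hk : (k : (u.under (𝓞 F)).adicCompletion F) ∈ (u.under (𝓞 F)).adicCompletionIntegers F) :
    ((algebraMap F E k : E) : u.adicCompletion E) ∈ u.adicCompletionIntegers E := by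
  rw [← toPlace_coe (E := E) (u.under (𝓞 F)) ⟨u, rfl⟩ k]
  exact toPlace_mem_adicCompletionIntegers (u.under (𝓞 F)) ⟨u, rfl⟩ hk

end Bookkeeping

/-! ## §2 The restricted tower identity -/
section Tower

variable (F E : Type) [Field F] [NumberField F] [Field E] [NumberField E] [Algebra F E]

/-- **TATE'S CHARACTER IN A TOWER, RESTRICTED FORM: `∏_{w ∣ v} ψ_{E,w}(ι_w t) = ψ_{F,v}(t)^{[E:F]}` for `t ∈ F_v`.**  Global approximation: `t ≡ k (mod 𝒪_v)` with
`k ∈ F` integral at the other places; `ψ_{F,v}(t) = e(Tr_{F∕ℚ} k)` (★ `adeleAddCharAt_eq_of_sub_mem`); the adele `x = Σ_{w∣v}(ι_w t at w)` satisfies `ψ_E(x) =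
∏_w ψ_{E,w}(ι_w t)` and `x − k` is finite-integral (`ι_w(t − k) ∈ 𝒪_w` over `v`, `k ∈ 𝒪_u` off `v`), so `ψ_E(x) = e(Tr_{E∕ℚ} k) = e([E:F] · Tr_{F∕ℚ} k)`.
(The local components are Tate's `ψ_𝔭 = λ ∘ Tr_{K_𝔭∕ℚ_p}`, so the full identity `ψ_{E,w} = ψ_{F,v} ∘ Tr_{E_w∕F_v}` holds; only its restriction to `F_v` is typed here.)
[cite: CasselsFrohlichANT1967, Ch. XV (Tate), §2.2, Lemma 4.1.3, Thm. 4.1.1] [cite: CasselsFrohlichANT1967, Ch. II §19 (19.18)] -/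
theorem prod_adeleAddCharAt_toPlace_eq_pow (v : HeightOneSpectrum (𝓞 F)) (t : v.adicCompletion F) :
    ∏ w : PlacesOver E v, adeleAddCharAt E w.1 (toPlace v w t) = adeleAddCharAt F v t ^ Module.finrank F E := by
  obtain ⟨k, hkv, hku⟩ := exists_sub_mem_adicCompletionIntegers_and_forall v t
  -- the adele `x = Σ_{w∣v} (ι_w t at w)` and its character value
  set x : AdeleRing (𝓞 E) E := ∑ w : PlacesOver E v, adeleSingleHom E w.1 (toPlace v w t) with hx
  have hψx : adeleAddChar E x = ∏ w : PlacesOver E v, adeleAddCharAt E w.1 (toPlace v w t) := by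
    rw [hx, Literature.Analysis.Fourier.addChar_map_finset_sum]
    rfl
  -- `x - k` is finite-integral
  have hfi : IsFiniteIntegral E (x - algebraMap E (AdeleRing (𝓞 E) E) (algebraMap F E k)) := by
    intro u
    change x.2 u - (algebraMap E (AdeleRing (𝓞 E) E) (algebraMap F E k)).2 u ∈ _
    rw [AdeleRing.algebraMap_snd]
    by_cases hu : u.under (𝓞 F) = v
    · rw [hx, adeleEval_sum_adeleSingleHom_of_over F E v (fun w => toPlace v w t) u hu]
      have hsub : toPlace v ⟨u, hu⟩ t - (algebraMap E (FiniteAdeleRing (𝓞 E) E) (algebraMap F E k)) u = toPlace v ⟨u, hu⟩ (t - (k : v.adicCompletion F)) := by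
        rw [map_sub, toPlace_coe]
        rfl
      rw [hsub]
      exact toPlace_mem_adicCompletionIntegers v ⟨u, hu⟩ hkv
    · rw [hx, adeleEval_sum_adeleSingleHom_of_not_over F E v (fun w => toPlace v w t) u hu, zero_sub]
      exact neg_mem (coe_algebraMap_mem_adicCompletionIntegers_of_under F E u k (hku _ hu))
  -- evaluate both sides through the principal element `k`
  have hEx : adeleAddChar E x = AddCircle.toCircle (((Algebra.trace ℚ E (algebraMap F E k) : ℚ) : ℝ) : AddCircle (1 : ℝ)) := by
    rw [adeleAddChar_apply, adeleTraceMod_eq E hfi, AdeleRing.fst_sub, hx, fst_sum_adeleSingleHom, zero_sub, map_neg, AdeleRing.algebraMap_fst,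
      infiniteAdeleTrace_algebraMap, AddCircle.coe_neg, neg_neg]
  have htr : Algebra.trace ℚ E (algebraMap F E k) = Module.finrank F E • Algebra.trace ℚ F k := by
    rw [← Algebra.trace_trace (S := F), Algebra.trace_algebraMap, map_nsmul]
  rw [← hψx, hEx, htr, adeleAddCharAt_eq_of_sub_mem F v hkv hku, ← AddCircle.toCircle_nsmul, ← AddCircle.coe_nsmul, nsmul_eq_mul, nsmul_eq_mul,
    Rat.cast_mul, Rat.cast_natCast]

/-- `adicComponent` spelling of `prod_adeleAddCharAt_toPlace_eq_pow` (★ (d1)'s currency `(adeleAddChar L).adicComponent w`; definitionally `adeleAddCharAt L w`).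
[cite: CasselsFrohlichANT1967, Ch. XV (Tate), §2.2, Thm. 4.1.1] -/
theorem prod_adicComponent_adeleAddChar_toPlace_eq_pow (v : HeightOneSpectrum (𝓞 F)) (t : v.adicCompletion F) :
    ∏ w : PlacesOver E v, (adeleAddChar E).adicComponent w.1 (toPlace v w t) = (adeleAddChar F).adicComponent v t ^ Module.finrank F E :=
  prod_adeleAddCharAt_toPlace_eq_pow F E v t

/-! ## §3 Corollaries: one place over `v`; Galois-conjugate places; two conjugate places in a quadratic tower -/

/-- **ONE PLACE OVER `v`** (e.g. `v` inert or ramified in a CM extension): `ψ_{E,w}(ι_w t) = ψ_{F,v}(t)^{[E:F]}` — for `[E:F] = 2`: `ψ_{L,w}(ι_w t) = ψ_{L⁺,v}(t)² =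
ψ_{L⁺,v}(2t)`. [cite: CasselsFrohlichANT1967, Ch. XV (Tate), §2.2, Thm. 4.1.1] -/
theorem adeleAddCharAt_toPlace_eq_pow_of_forall_eq (v : HeightOneSpectrum (𝓞 F)) (w : PlacesOver E v) (hw : ∀ w' : PlacesOver E v, w' = w)
    (t : v.adicCompletion F) :
    adeleAddCharAt E w.1 (toPlace v w t) = adeleAddCharAt F v t ^ Module.finrank F E := by
  rw [← prod_adeleAddCharAt_toPlace_eq_pow F E v t, Fintype.prod_eq_single w fun w' hw' => absurd (hw w') hw']

/-- **GALOIS-CONJUGATE PLACES OVER `v` HAVE THE SAME LOCAL CHARACTER ON `ι(F_v)`**: `σ • w = w′` ⇒ `ψ_{E,w′}(ι_{w′} t) = ψ_{E,w}(ι_w t)` (★ equivariance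
`adeleAddCharAt_galAdicCompletionMap` + ★ `galAdicCompletionMap_toPlace`). [cite: Tate1950, §2.2] [cite: CasselsFrohlichANT1967, Ch. XV (Tate), §2.2] -/
theorem adeleAddCharAt_toPlace_eq_of_smul_eq (σ : E ≃ₐ[F] E) {v : HeightOneSpectrum (𝓞 F)} (w w' : PlacesOver E v) (h : σ • w.1 = w'.1)
    (t : v.adicCompletion F) :
    adeleAddCharAt E w'.1 (toPlace v w' t) = adeleAddCharAt E w.1 (toPlace v w t) := by
  rw [← galAdicCompletionMap_toPlace σ w w' h t, adeleAddCharAt_galAdicCompletionMap F σ h]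

/-- **TWO CONJUGATE PLACES IN A QUADRATIC TOWER** (e.g. `v` split in a CM `L∕L⁺`): if `[E:F] = 2` and the places over `v` are exactly `w ≠ w′ = σ • w`, then
`ψ_{E,w}(ι_w t) = ψ_{F,v}(t)` for every `t ∈ F_v` (apply §2 to `t∕2`: `ψ_{E,w}(ι_w t) = ψ_{E,w}(ι_w (t∕2))·ψ_{E,w′}(ι_{w′}(t∕2)) = ψ_{F,v}(t∕2)² = ψ_{F,v}(t)`).
[cite: CasselsFrohlichANT1967, Ch. XV (Tate), §2.2, Thm. 4.1.1] [cite: CasselsFrohlichANT1967, Ch. II §19 (19.18)] -/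
theorem adeleAddCharAt_toPlace_eq_of_pair (hEF : Module.finrank F E = 2) (σ : E ≃ₐ[F] E) {v : HeightOneSpectrum (𝓞 F)} (w w' : PlacesOver E v)
    (hne : w ≠ w') (h : σ • w.1 = w'.1) (hall : ∀ u : PlacesOver E v, u = w ∨ u = w') (t : v.adicCompletion F) :
    adeleAddCharAt E w.1 (toPlace v w t) = adeleAddCharAt F v t := by
  haveI : CharZero (v.adicCompletion F) := charZero_of_injective_algebraMap (algebraMap F (v.adicCompletion F)).injective
  -- halve `t`
  set s : v.adicCompletion F := (2 : v.adicCompletion F)⁻¹ * t with hs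
  have hts : t = s + s := by
    rw [hs, ← two_mul, ← mul_assoc, mul_inv_cancel₀ (two_ne_zero' (v.adicCompletion F)), one_mul]
  have huniv : (Finset.univ : Finset (PlacesOver E v)) = {w, w'} := by
    ext u
    simp only [Finset.mem_univ, Finset.mem_insert, Finset.mem_singleton, true_iff]
    exact hall u
  have hprod := prod_adeleAddCharAt_toPlace_eq_pow F E v s
  rw [huniv, Finset.prod_pair hne, adeleAddCharAt_toPlace_eq_of_smul_eq F E σ w w' h s, hEF] at hprod
  rw [hts, map_add, AddChar.map_add_eq_mul, AddChar.map_add_eq_mul, hprod, sq]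

end Tower

/-! ## §4 (ED. 2) The fixed subalgebra of `σ ⊗ 1` on `E ⊗_F F_v = ∏_{w∣v} E_w` is `ι_v(F_v)`; on it the product of the local characters is `ψ_{F,v} ∘ Tr`

EDITION 2 (append-only; §§1–3 byte-identical).  The S-letter `hχ` reads the unipotent character on HERMITIAN pairings `tr(b·βloc)`, which are fixed by the conjugation
`σ ⊗ 1 = conjLocal` of `E ⊗_F F_v`; in a quadratic tower these are exactly the elements `ι_v(t)`, `t ∈ F_v` (★ `quadraticLocalEquiv`: `E ⊗_F F_v = F_v ⊕ F_v δ`,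
`(σ ⊗ 1)(a + bδ) = a − bδ`), on which §2 applies and `Tr_{E⊗F_v ∕ F_v}(ι_v t) = 2t`.  So for every `σ ⊗ 1`-fixed `x`: `∏_{w∣v} ψ_{E,w}(x_w) = ψ_{F,v}(Tr x)` — the
`ψ_L ↔ ψ_{L⁺}` link in the form the hermitian model consumes (CM instance: `E := L`, `F := L⁺`, `σ := complexConj`, `δ := imagUnit`, ★ `complexConj_imagUnit`,
★ `imagUnit_ne_zero`, `IsCMField.isQuadraticExtension`). -/
section Fixed

variable (F E : Type) [Field F] [NumberField F] [Field E] [NumberField E] [Algebra F E]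

/-- **THE FIXED POINTS OF `σ ⊗ 1` ON `E ⊗_F F_v` ARE `ι_v(F_v)`** (quadratic `E∕F`, `σ δ = −δ`, `δ ≠ 0`): `conjLocal σ x = x ↔ ∃ t, x = ι_v t` — in the coordinates
`x = ι_v a + ι_v b · δ` (★ `existsUnique_eq_add_mul`), `(σ ⊗ 1) x = ι_v a − ι_v b · δ` (★ `conjLocal_quadraticLocalEquiv`), so `b = −b`, `b = 0`.
[cite: CasselsFrohlichANT1967, Ch. II §10–§11] -/
theorem conjLocal_eq_self_iff [Algebra.IsQuadraticExtension F E] (v : HeightOneSpectrum (𝓞 F)) (σ : E ≃ₐ[F] E) {δ : E} (hσδ : σ δ = -δ) (hδ : δ ≠ 0)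
    (x : LocalRing E v) : conjLocal E σ v x = x ↔ ∃ t : v.adicCompletion F, x = toLocalRing E v t := by
  constructor
  · intro hx
    obtain ⟨p, hp, -⟩ := existsUnique_eq_add_mul E v σ hσδ hδ x
    have hxp : x = quadraticLocalEquiv E v σ hσδ hδ (p.1, p.2) := by rw [quadraticLocalEquiv_apply]; exact hp
    have heq : quadraticLocalEquiv E v σ hσδ hδ (p.1, -p.2) = quadraticLocalEquiv E v σ hσδ hδ (p.1, p.2) := by
      rw [← conjLocal_quadraticLocalEquiv, ← hxp, hx]
    have h2 : -p.2 = p.2 := by simpa using congrArg Prod.snd ((quadraticLocalEquiv E v σ hσδ hδ).injective heq)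
    haveI : CharZero (v.adicCompletion F) := charZero_of_injective_algebraMap (algebraMap F (v.adicCompletion F)).injective
    have hp2 : p.2 = 0 := by
      have h : (2 : v.adicCompletion F) * p.2 = 0 := by rw [two_mul]; nth_rewrite 1 [← h2]; rw [neg_add_cancel]
      exact (mul_eq_zero.1 h).resolve_left two_ne_zero
    refine ⟨p.1, ?_⟩
    rw [hp, hp2, map_zero, zero_mul, add_zero]
  · rintro ⟨t, rfl⟩
    exact conjLocal_toLocalRing σ v t

/-- **`Tr_{E ⊗ F_v ∕ F_v}(ι_v t) = 2t`** (quadratic `E∕F`; ★ `algebraMap_localRing_eq`, Mathlib `Algebra.trace_algebraMap`, ★ `finrank_localRing`).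
[cite: CasselsFrohlichANT1967, Ch. II §19 (19.9)] -/
theorem trace_toLocalRing [Algebra.IsQuadraticExtension F E] (v : HeightOneSpectrum (𝓞 F)) (t : v.adicCompletion F) :
    Algebra.trace (v.adicCompletion F) (LocalRing E v) (toLocalRing E v t) = 2 • t := by
  rw [← algebraMap_localRing_eq, Algebra.trace_algebraMap, finrank_localRing]

/-- **ON THE `σ ⊗ 1`-FIXED SUBALGEBRA THE PRODUCT OF THE LOCAL CHARACTERS IS `ψ_{F,v} ∘ Tr`**: for `conjLocal σ x = x`,
`∏_{w∣v} ψ_{E,w}(x_w) = ψ_{F,v}(Tr_{E⊗F_v ∕ F_v} x)` (`x = ι_v t` by `conjLocal_eq_self_iff`, §2's `prod_adeleAddCharAt_toPlace_eq_pow` with `[E:F] = 2`, `Tr(ι_v t) = 2t`).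
This is the form the hermitian pairings `tr(b·βloc) ∈ (L ⊗ L⁺_v)^{σ⊗1}` of ★ U2a's line model consume. [cite: CasselsFrohlichANT1967, Ch. XV (Tate), §2.2, Thm. 4.1.1]
[cite: CasselsFrohlichANT1967, Ch. II §19 (19.18)] -/
theorem prod_adeleAddCharAt_eq_adeleAddCharAt_trace_of_conjLocal_eq [Algebra.IsQuadraticExtension F E] (v : HeightOneSpectrum (𝓞 F)) (σ : E ≃ₐ[F] E)
    {δ : E} (hσδ : σ δ = -δ) (hδ : δ ≠ 0) (x : LocalRing E v) (hx : conjLocal E σ v x = x) :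
    ∏ w : PlacesOver E v, adeleAddCharAt E w.1 (x w) = adeleAddCharAt F v (Algebra.trace (v.adicCompletion F) (LocalRing E v) x) := by
  obtain ⟨t, rfl⟩ := (conjLocal_eq_self_iff F E v σ hσδ hδ x).1 hx
  rw [trace_toLocalRing, AddChar.map_nsmul_eq_pow, ← Algebra.IsQuadraticExtension.finrank_eq_two F E, ← prod_adeleAddCharAt_toPlace_eq_pow F E v t]
  rfl

/-- `adicComponent` spelling of the previous theorem (★ (d1) `unipDeltaChar_locToAdelic_eq_prod`'s currency). [cite: CasselsFrohlichANT1967, Ch. XV (Tate), §2.2, Thm. 4.1.1] -/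
theorem prod_adicComponent_eq_adicComponent_trace_of_conjLocal_eq [Algebra.IsQuadraticExtension F E] (v : HeightOneSpectrum (𝓞 F)) (σ : E ≃ₐ[F] E)
    {δ : E} (hσδ : σ δ = -δ) (hδ : δ ≠ 0) (x : LocalRing E v) (hx : conjLocal E σ v x = x) :
    ∏ w : PlacesOver E v, (adeleAddChar E).adicComponent w.1 (x w) = (adeleAddChar F).adicComponent v (Algebra.trace (v.adicCompletion F) (LocalRing E v) x) :=
  prod_adeleAddCharAt_eq_adeleAddCharAt_trace_of_conjLocal_eq F E v σ hσδ hδ x hx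

end Fixed

end Summit.HodgeConjecture.HodgeConjecture.Cruxes.HLiu418.K2LiuAdeleAddCharTower

end
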